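import Summits.Ventures.WeilGRH.FlatWindowConstantsCentral
import Literature.NumberTheory.LFunctions.ExplicitFormulaPsiCharLogDeriv
import Literature.NumberTheory.LFunctions.DirichletLZeroCountingTwoSided
import HarnessLib

/-!
# GRH arm (rh-explicit, venture WeilGRH): the `χ`-rung bounds the twisted prime sum below its horizon by
  the CENTRAL VALUE `−2 Re (L′/L)(½, χ)`

Cell `rh-explicit`, WEIL TRACK (structure seat weil-3, gen8).  Sequel of `FlatWindowConstantsCentral.lean`
(`K_κ = −2(Γ_ℝ′/Γ_ℝ)(½ + κ)`, `ζ′(½)/ζ(½) = (log 8π + γ + π/2)/2`, `zetaFlatSum_le_central`).  Here the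
`χ`-twin: for a primitive `χ` mod `q ≠ 1` with `L(½, χ) ≠ 0`, the functional equation in logarithmic
form (`ExplicitPsiChar.logDeriv_LFunction_eq_reflect`, Montgomery–Vaughan (10.35)) at its centre `s = ½`
together with `(L′/L)(½, χ̄) = conj (L′/L)(½, χ)` (`DirichletTheta.logDeriv_LFunction_conj`) gives the
UNCONDITIONAL central identity

  `Re (L′/L)(½, χ) = −(log q)/2 − (Γ_ℝ′/Γ_ℝ)(½ + κ) = −(log q − K_κ)/2`   (`re_logDeriv_LFunction_one_half`),

i.e. `−2 Re (L′/L)(½, χ) = log q − K_κ = log(q/π) + ψ((2κ+1)/4)` — the `χ`-analogue of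
`ζ′(½)/ζ(½) = K₀/2` (where the pole of `ζ` flips the sign).  Consequently the flat-window inequality of
`TwistedFlatTest.lean` reads (`flatSum_le_neg_two_re_logDeriv_LFunction`):

  `WeilPositivityOnChar χ a  ⟹  2Σ_{log n<2a} Λ(n)n^{-1/2}(1 − log n/(2a)) Re χ(n) ≤ −2 Re (L′/L)(½, χ) + I_κ(a)/a`:

**a rung at window `a` bounds the smoothed twisted prime sum below `e^{2a}` by the central value of
`−2 Re L′/L`, with slack `I_κ(a)/a → 0`** (under GRH(χ) the explicit formula gives
`2Σ_{n<x}Λ(n)n^{-1/2}(1 − log n/log x)Re χ(n) → −2Re(L′/L)(½, χ)`, so the bound is asymptotically sharp;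
WEIL3-STRUCTURE §15.2 (vi)).  Under `GRH(χ)` the inequality holds at every window (`…_of_grh`).

No definitions, no named facts; RH/GRH-free except the `_of_grh` corollary.

## References

* H. L. Montgomery, R. C. Vaughan, *Multiplicative Number Theory I* (2007), (10.35), Lemma 12.8, §10.1.
  [MontgomeryVaughan2007]
* A. Weil, *Sur les "formules explicites" de la théorie des nombres premiers* (1952), (11) pp. 261–262.
  [Weil1952FormulesExplicites]
-/

set_option autoImplicit false

noncomputable section

open Complex Filter Set MeasureTheory
open scoped Real Topology ComplexConjugate ArithmeticFunction.vonMangoldt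

namespace Summit.Ventures.WeilGRH

open Literature.NumberTheory.LFunctions DirichletCharacter

variable {q : ℕ} [NeZero q] {χ : DirichletCharacter ℂ q} {a : ℝ}

/-! ## The Gamma factor at the central point -/

/-- `γ(½, χ) = Γ_ℝ(½ + κ) ≠ 0` and `(γ′/γ)(½, χ) = (Γ_ℝ′/Γ_ℝ)(½ + κ)` (`κ = charParity χ`). -/
theorem gammaFactor_one_half_ne_zero_and_logDeriv (χ : DirichletCharacter ℂ q) :
    gammaFactor χ (1 / 2) ≠ 0 ∧
      logDeriv (gammaFactor χ) (1 / 2) = logDeriv Gammaℝ (1 / 2 + (charParity χ : ℂ)) := by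
  rcases χ.even_or_odd with hχ | hχ
  · have hfun : gammaFactor χ = Gammaℝ := funext fun z ↦ hχ.gammaFactor_def z
    rw [hfun, charParity_of_even hχ, Nat.cast_zero, add_zero]
    exact ⟨Gammaℝ_ne_zero_of_re_pos (by norm_num), rfl⟩
  · have hfun : gammaFactor χ = Gammaℝ ∘ fun z ↦ z + 1 := funext fun z ↦ hχ.gammaFactor_def z
    have h32 : (1 / 2 : ℂ) + 1 = 3 / 2 := by norm_num
    have hne : Gammaℝ (3 / 2) ≠ 0 := Gammaℝ_ne_zero_of_re_pos (by norm_num)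
    have hpole : ∀ m : ℕ, (3 / 2 : ℂ) / 2 ≠ -m := fun m h ↦ by
      have := congrArg Complex.re h
      simp at this
      have hm : (0 : ℝ) ≤ m := m.cast_nonneg
      linarith
    have hd : DifferentiableAt ℂ Gammaℝ ((fun z : ℂ ↦ z + 1) (1 / 2)) := by
      show DifferentiableAt ℂ Gammaℝ ((1 : ℂ) / 2 + 1)
      rw [h32]; exact (RealZeros.hasDerivAt_Gammaℝ hpole).differentiableAt
    have hg : DifferentiableAt ℂ (fun z : ℂ ↦ z + 1) (1 / 2 : ℂ) := differentiableAt_id.add_const 1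
    rw [hfun, charParity_of_odd hχ, Nat.cast_one]
    refine ⟨?_, ?_⟩
    · show Gammaℝ ((1 : ℂ) / 2 + 1) ≠ 0
      rw [h32]; exact hne
    · rw [logDeriv_comp (f := Gammaℝ) (g := fun z : ℂ ↦ z + 1) (x := (1 / 2 : ℂ)) hd hg, deriv_add_const,
        deriv_id'', mul_one]

/-! ## `Re (L′/L)(½, χ)` from the functional equation -/

/-- **`Re (L′/L)(½, χ) = −(log q)/2 − (Γ_ℝ′/Γ_ℝ)(½ + κ)`**, unconditionally, for `χ` primitive mod `q`,
`χ ≠ 1`, `L(½, χ) ≠ 0`: the logarithmic functional equation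
`L′/L(s, χ) = −log q − L′/L(1 − s, χ̄) − γ′/γ(1 − s) − γ′/γ(s)` at `s = ½` with
`(L′/L)(½, χ̄) = conj (L′/L)(½, χ)` (so the two `L′/L` terms have the same real part). -/
theorem re_logDeriv_LFunction_one_half (hprim : χ.IsPrimitive) (hχ : χ ≠ 1)
    (hL : χ.LFunction (1 / 2) ≠ 0) :
    (logDeriv χ.LFunction (1 / 2)).re =
      -(Real.log q) / 2 - (logDeriv Gammaℝ (1 / 2 + (charParity χ : ℂ))).re := by
  obtain ⟨hG, hGlog⟩ := gammaFactor_one_half_ne_zero_and_logDeriv χ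
  -- `L(½, χ̄) ≠ 0` from `L(½, χ) ≠ 0`
  have hconj : logDeriv χ.LFunction (1 / 2) = conj (logDeriv χ⁻¹.LFunction (1 / 2)) := by
    have h := DirichletTheta.logDeriv_LFunction_conj (χ := χ) hχ (1 / 2)
    rwa [show conj (1 / 2 : ℂ) = 1 / 2 by rw [map_div₀, map_one, map_ofNat]] at h
  have hL1 : χ⁻¹.LFunction (1 - 1 / 2) ≠ 0 := by
    rw [show (1 : ℂ) - 1 / 2 = 1 / 2 by norm_num]
    have h := DirichletZFR.conj_LFunction_conj χ hχ (conj (1 / 2))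
    rw [Complex.conj_conj, show conj (1 / 2 : ℂ) = 1 / 2 by rw [map_div₀, map_one, map_ofNat]] at h
    rw [← h]
    exact (map_ne_zero _).2 hL
  have hG1 : gammaFactor χ (1 - 1 / 2) ≠ 0 := by rwa [show (1 : ℂ) - 1 / 2 = 1 / 2 by norm_num]
  obtain ⟨-, hfe⟩ := ExplicitPsiChar.logDeriv_LFunction_eq_reflect hprim hχ hG hG1 hL1
  rw [show (1 : ℂ) - 1 / 2 = 1 / 2 by norm_num, hGlog] at hfe
  -- take real parts: `Re z = −log q − Re z − 2 Re(Γ_ℝ′/Γ_ℝ)`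
  have hre := congrArg Complex.re hfe
  have hzbar : (logDeriv χ⁻¹.LFunction (1 / 2)).re = (logDeriv χ.LFunction (1 / 2)).re := by
    rw [hconj, Complex.conj_re]
  simp only [Complex.sub_re, Complex.neg_re, Complex.ofReal_re] at hre
  rw [hzbar] at hre
  linarith

/-- **`−2 Re (L′/L)(½, χ) = log q − K_κ`**: twice the central value equals the conductor minus the
flat-window constant of the parity (`K_κ = −2(Γ_ℝ′/Γ_ℝ)(½ + κ) = log π − ψ((2κ+1)/4)`). -/
theorem neg_two_mul_re_logDeriv_LFunction_one_half (hprim : χ.IsPrimitive) (hχ : χ ≠ 1)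
    (hL : χ.LFunction (1 / 2) ≠ 0) :
    -2 * (logDeriv χ.LFunction (1 / 2)).re =
      Real.log q - (Real.log (4 * π) + Real.eulerMascheroniConstant +
        2 * ∫ t in Ioi (0 : ℝ), weilKillingDensityPar (charParity χ) t) := by
  rw [re_logDeriv_LFunction_one_half hprim hχ hL]
  have hκ := charParity_le_one χ
  interval_cases hc : charParity χ
  · rw [flatWindow_const_zero_eq, Nat.cast_zero, add_zero, logDeriv_Gammaℝ_one_half, Complex.neg_re,
      Complex.ofReal_re]
    ring
  · rw [flatWindow_const_one_eq, Nat.cast_one, show (1 / 2 : ℂ) + 1 = 3 / 2 by norm_num,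
      logDeriv_Gammaℝ_three_halves, Complex.neg_re, Complex.ofReal_re]
    ring

/-! ## The rung bounds the twisted prime sum by the central value -/

/-- **THE FLAT-WINDOW INEQUALITY AT THE CENTRAL VALUE.**  For `χ` primitive mod `q ≠ 1` with
`L(½, χ) ≠ 0` and a window `a > 0`:

  `WeilPositivityOnChar χ a ⟹ 2Σ_{log n<2a} Λ(n) n^{-1/2} (1 − log n/(2a)) Re χ(n) ≤ −2 Re (L′/L)(½, χ) + I_κ(a)/a`

(`I_κ(a) = ∫₀^∞ e^{(1/2−κ)t}/(2 sinh t)·min(t, 2a) dt ≤ 5`): the rung bounds the smoothed twisted prime sum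
below its horizon `e^{2a}` by the central value of `−2 Re L′/L`, with a slack `I_κ(a)/a → 0`.  RH/GRH-free
(only the functional equation enters). -/
theorem flatSum_le_neg_two_re_logDeriv_LFunction (hq : q ≠ 1) (hprim : χ.IsPrimitive) (hχ : χ ≠ 1)
    (hL : χ.LFunction (1 / 2) ≠ 0) (ha : 0 < a) (hW : WeilPositivityOnChar χ a) :
    2 * (∑ n ∈ weilPrimeIndex a,
          (Λ n : ℝ) / Real.sqrt n * ((1 - Real.log n / (2 * a)) * (χ (n : ZMod q)).re)) ≤
      -2 * (logDeriv χ.LFunction (1 / 2)).re +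
        1 / a * ∫ t in Ioi (0 : ℝ), weilArchDensityPar (charParity χ) t * min t (2 * a) := by
  have h := flatWindow_le_log_of_weilPositivityOnChar hq χ ha hW
  rw [neg_two_mul_re_logDeriv_LFunction_one_half hprim hχ hL]
  linarith

/-- With numbers: `2Σ_{log n<2a} Λ(n)n^{-1/2}(1 − log n/(2a))Re χ(n) ≤ −2 Re (L′/L)(½, χ) + 5/a`. -/
theorem flatSum_le_neg_two_re_logDeriv_LFunction_add (hq : q ≠ 1) (hprim : χ.IsPrimitive) (hχ : χ ≠ 1)
    (hL : χ.LFunction (1 / 2) ≠ 0) (ha : 0 < a) (hW : WeilPositivityOnChar χ a) :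
    2 * (∑ n ∈ weilPrimeIndex a,
          (Λ n : ℝ) / Real.sqrt n * ((1 - Real.log n / (2 * a)) * (χ (n : ZMod q)).re)) ≤
      -2 * (logDeriv χ.LFunction (1 / 2)).re + 5 / a := by
  have h := flatSum_le_neg_two_re_logDeriv_LFunction hq hprim hχ hL ha hW
  have hI := integral_weilArchDensityPar_mul_min_le_five (charParity χ) ha.le
  have hIa : 1 / a * ∫ t in Ioi (0 : ℝ), weilArchDensityPar (charParity χ) t * min t (2 * a) ≤ 5 / a := by
    rw [one_div_mul_eq_div]
    exact div_le_div_of_nonneg_right hI ha.le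
  linarith

/-- **Under `GRH(χ)`: at every window.**  For `χ` primitive mod `q ≠ 1` with `GRH(χ)` and `L(½, χ) ≠ 0`,
every `a > 0` gives `2Σ_{log n<2a}Λ(n)n^{-1/2}(1 − log n/(2a))Re χ(n) ≤ −2Re(L′/L)(½, χ) + I_κ(a)/a` — and
the explicit formula makes the left side converge to the right side's first term as `a → ∞`
(asymptotic sharpness, argued in WEIL3-STRUCTURE §15.2 (vi)). -/
theorem flatSum_le_neg_two_re_logDeriv_LFunction_of_grh (hq : q ≠ 1) (hprim : χ.IsPrimitive)
    (hGRH : χ.RiemannHypothesis) (hL : χ.LFunction (1 / 2) ≠ 0) (ha : 0 < a) :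
    2 * (∑ n ∈ weilPrimeIndex a,
          (Λ n : ℝ) / Real.sqrt n * ((1 - Real.log n / (2 * a)) * (χ (n : ZMod q)).re)) ≤
      -2 * (logDeriv χ.LFunction (1 / 2)).re +
        1 / a * ∫ t in Ioi (0 : ℝ), weilArchDensityPar (charParity χ) t * min t (2 * a) := by
  have hχ : χ ≠ 1 := by
    rintro rfl
    apply hq
    have h := (DirichletCharacter.isPrimitive_def (1 : DirichletCharacter ℂ q)).1 hprim
    rw [DirichletCharacter.conductor_one] at h
    exact h.symm
  exact flatSum_le_neg_two_re_logDeriv_LFunction hq hprim hχ hL ha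
    ((WeilPositivityChar.of_grh hq hprim hGRH).on a)

end Summit.Ventures.WeilGRH

end
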